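import Literature.NumberTheory.Transcendental.StrongSixExponentialsLinAlg
import Literature.NumberTheory.Transcendental.DiazZeroLemmaProofs
import Mathlib.LinearAlgebra.FreeModule.PID
import HarnessLib

/-!
# The strong six exponentials theorem, II: exclusion of the obstructing subgroup

Topic `Literature/NumberTheory/Transcendental`. Second file of the proof of the strong six
exponentials theorem (`Literature.Barriers.Schanuel.roy1992_strongSixExponentials`; Roy 1992 §4
Cor. 2 = [Waldschmidt2005, Thm 2.1] = [Waldschmidt2005, Thm 3.1, `d = 2`]) through Waldschmidt's
linear subgroup theorem on `𝔾ₐ × 𝔾ₘ^N` (`linearSubgroup_GaGm`, `LinearSubgroupGaGm*.lean`).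

In the pencil case (some `ℚ̄`-combination of the two rows has no constant terms) the data are: a
point `(a₁, a₂, a₃)` of `L̃³` with `a_j` linearly independent over a number field `K`, `t ∉ K`
with `t a_j ∈ L`-part, a `ℚ`-basis `ω` of (a subfield of) `K` with `ω₀ = 1`, and the `3D`
generators `ω_r (a_j, t a_j)` of `G = 𝔾ₐ × 𝔾ₘ^{2D}` encoded by
`ω_r a_j = θ_{jr} + ω·x_{jr}`, `ω_r t a_j = ω·y_{jr}`; the letters span
`W ⊆ {z + ω·x = 0, ω·y = 0}`, `dim W ≥ 2D - 1`. The theorem `exclusion` shows that NO connected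
algebraic subgroup `G' = V₀ × T_M` of `G` together with `r'` independent relations
`σ(ρᵢ) ∈ G'(ℂ)` can satisfy the two counting inequalities
`τ < δ`, `(3D - r') + δ₁ + 2Dτ ≤ 2Dδ` of the linear subgroup theorem: writing `T = Lie T_M`,
`f₁ = (ω, 0)·`, `f₂ = (0, ω)·`, `W ∩ Lie G'` injects into `T ∩ ker f₂` (`∩ ker f₁` if `V₀ = 0`), so

* `V₀ = 𝔾ₐ`: `τ < δ` forces `T ⊆ ker f₂`, hence `(0, ω) ∈ span_ℂ X(T_M) = span_K X(T_M)`
  (bi-orthogonality + rational choice), so `t a(ν) = 2πi ∑ cᵢ kᵢ(ν)` on relations: the map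
  `ν ↦ (χᵢ · log σ(ν))ᵢ ∈ (2πiℤ)^{rk M}` is injective on relations, `r' ≤ rk M = 2D - dim T`,
  against `r' ≥ 3D - dim T` from the second inequality;
* `V₀ = 0`, `dim (T ∩ ker f₁ ∩ ker f₂) = dim T - 1`: a pencil `αf₁ + βf₂` vanishes on `T`, with
  `(α, β) ∈ K² ∖ 0` by rational choice, and `(α + βt) a(ν) = 2πi ∑ cᵢ kᵢ(ν)`, `α + βt ≠ 0`: same
  count;
* `V₀ = 0`, `T ⊆ ker f₁ ∩ ker f₂`: the rational points show `T = 0`, the count gives a non-zero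
  relation `ν`, all of whose logarithmic coordinates lie in `2πi K`; then
  `a(ν) ∈ 2πi K^×`, `t a(ν) ∈ 2πi K`, so `t ∈ K` — contradiction.

(`a(ν) = ∑ ν_{jr} ω_r a_j ≠ 0` for `ν ≠ 0` by the independence of the `a_j` over `K` and of `ω`
over `ℚ`.) Everything is PROVED; no definitions, no named facts.

## References

* [Waldschmidt2005] M. Waldschmidt, *Variations on the six exponentials theorem*, Algebra and
  Number Theory (Hyderabad 2003), Hindustan Book Agency 2005, 338–355, Thm 2.1, Thm 3.1, §3.
* D. Roy, *Matrices whose coefficients are linear forms in logarithms*, J. Number Theory 41 (1992),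
  22–47, §4 Cor. 2.
* [Waldschmidt1988] M. Waldschmidt, *On the transcendence methods of Gel'fond and Schneider in
  several variables*, New Advances in Transcendence Theory, CUP 1988, Ch. 24, Thm 4.1.
-/

noncomputable section

open Module Submodule

namespace Literature.NumberTheory.Transcendental.StrongSixExponentials

/-! ### Characters and the torus tangent space -/

section Exclusion

open GaGm DiazZL Baker1975.Ch3

variable {N : ℕ}

/-- **A `ℤ`-basis of the character group** of a connected algebraic subgroup (a subgroup of the
free group `ℤ^N`, `Submodule.basisOfPid`). [folklore] -/
theorem exists_chars_basis (H : ConnAlgSubgroup N) :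
    ∃ (kk : ℕ) (χ : Fin kk → Fin N → ℤ), LinearIndependent ℤ χ ∧ (∀ i, χ i ∈ H.chars) ∧
      ∀ χ' ∈ H.chars, χ' ∈ Submodule.span ℤ (Set.range χ) := by
  classical
  set S : Submodule ℤ (Fin N → ℤ) := AddSubgroup.toIntSubmodule H.chars with hS
  obtain ⟨kk, b⟩ := Submodule.basisOfPid (Pi.basisFun ℤ (Fin N)) S
  refine ⟨kk, fun i => (b i : Fin N → ℤ), ?_, fun i => ?_, fun χ' hχ' => ?_⟩
  · exact b.linearIndependent.map' S.subtype (Submodule.ker_subtype S)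
  · exact (b i).2
  · have hχS : χ' ∈ S := hχ'
    have hmem : (⟨χ', hχS⟩ : S) ∈ Submodule.span ℤ (Set.range b) := by
      rw [b.span_eq]; trivial
    have := Submodule.apply_mem_span_image_of_mem_span S.subtype hmem
    rw [← Set.range_comp] at this
    simpa [Function.comp_def] using this

/-- The torus tangent space is cut out by a basis of the characters. [folklore] -/
theorem mem_torusTangent_iff_basis (H : ConnAlgSubgroup N) {kk : ℕ} {χ : Fin kk → Fin N → ℤ}
    (hχ : ∀ i, χ i ∈ H.chars) (hsp : ∀ χ' ∈ H.chars, χ' ∈ Submodule.span ℤ (Set.range χ))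
    (v : Fin N → ℂ) : v ∈ H.torusTangent ↔ ∀ i, ∑ j, (χ i j : ℂ) * v j = 0 := by
  constructor
  · intro hv i; exact hv (χ i) (hχ i)
  · intro hv χ' hχ'
    obtain ⟨c, hc⟩ := (Submodule.mem_span_range_iff_exists_fun ℤ).mp (hsp χ' hχ')
    rw [← hc]
    simp only [Finset.sum_apply, Pi.smul_apply, smul_eq_mul, Int.cast_sum, Int.cast_mul, Finset.sum_mul]
    rw [Finset.sum_comm]
    refine Finset.sum_eq_zero fun i _ => ?_
    simp_rw [mul_assoc]
    rw [← Finset.mul_sum, hv i, mul_zero]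

/-- `dim T_M + rank M = N`. [folklore] -/
theorem finrank_torusTangent_add (H : ConnAlgSubgroup N) {kk : ℕ} {χ : Fin kk → Fin N → ℤ}
    (hind : LinearIndependent ℤ χ) (hχ : ∀ i, χ i ∈ H.chars)
    (hsp : ∀ χ' ∈ H.chars, χ' ∈ Submodule.span ℤ (Set.range χ)) :
    finrank ℂ H.torusTangent + kk = N := by
  set w : Matrix (Fin kk) (Fin N) ℂ := fun i j => (χ i j : ℂ) with hw
  have hrow : LinearIndependent ℂ w.row := linearIndependent_cast_of_int χ hind
  have hker : H.torusTangent = LinearMap.ker w.mulVecLin := by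
    ext v
    rw [mem_torusTangent_iff_basis H hχ hsp, LinearMap.mem_ker, Matrix.mulVecLin_apply]
    constructor
    · intro h; funext i; simpa [Matrix.mulVec, dotProduct, hw] using h i
    · intro h i; have := congrFun h i; simpa [Matrix.mulVec, dotProduct, hw] using this
  rw [hker]
  exact Waldschmidt1981.finrank_ker_mulVecLin_of_linearIndependent w hrow

/-- **Bi-orthogonality against a basis of characters.** [folklore] -/
theorem mem_span_basis_of_forall (H : ConnAlgSubgroup N) {kk : ℕ} {χ : Fin kk → Fin N → ℤ}
    (hsp : ∀ χ' ∈ H.chars, χ' ∈ Submodule.span ℤ (Set.range χ))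
    (u : Fin N → ℂ) (hu : ∀ v ∈ H.torusTangent, ∑ j, u j * v j = 0) :
    u ∈ Submodule.span ℂ (Set.range fun i j => (χ i j : ℂ)) := by
  have h1 := mem_span_intCast_of_forall (H.chars : Set (Fin N → ℤ)) u (fun v hv => hu v hv)
  refine Submodule.span_le.mpr ?_ h1
  rintro _ ⟨χ', hχ', rfl⟩
  obtain ⟨c, hc⟩ := (Submodule.mem_span_range_iff_exists_fun ℤ).mp (hsp χ' hχ')
  have : (fun j => ((χ' j : ℤ) : ℂ)) = ∑ i, (c i : ℂ) • fun j => (χ i j : ℂ) := by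
    rw [← hc]; funext j; simp [Finset.sum_apply]
  show (fun j => ((χ' j : ℤ) : ℂ)) ∈ (Submodule.span ℂ (Set.range fun i j => (χ i j : ℂ)) : Set (Fin N → ℂ))
  rw [this]
  exact Submodule.sum_mem _ fun i _ => Submodule.smul_mem _ _ (Submodule.subset_span ⟨i, rfl⟩)

/-- The two coordinate functionals `f₁(v) = ∑ ωₛ v_{x,s}`, `f₂(v) = ∑ ωₛ v_{y,s}` on `ℂ^{D+D}` as
dot products with `(ω, 0)` and `(0, ω)`. [folklore] -/
theorem dot_append_left {D : ℕ} (ω : Fin D → ℂ) (v : Fin (D + D) → ℂ) :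
    ∑ j, Fin.append ω (0 : Fin D → ℂ) j * v j = ∑ s, ω s * v (Fin.castAdd D s) := by
  rw [Fin.sum_univ_add]
  simp only [Fin.append_left, Fin.append_right, Pi.zero_apply, zero_mul, Finset.sum_const_zero, add_zero]

/-- Companion of `dot_append_left`. [folklore] -/
theorem dot_append_right {D : ℕ} (ω : Fin D → ℂ) (v : Fin (D + D) → ℂ) :
    ∑ j, Fin.append (0 : Fin D → ℂ) ω j * v j = ∑ s, ω s * v (Fin.natAdd D s) := by
  rw [Fin.sum_univ_add]
  simp only [Fin.append_left, Fin.append_right, Pi.zero_apply, zero_mul, Finset.sum_const_zero, zero_add]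

/-- **Injectivity of `ν ↦ a(ν) = ∑ ν_{jr} ω_r a_j`** (`a_j` independent over `K ∋ ω_r`, `ω`
independent over `ℚ`). [folklore] -/
theorem rel_eq_zero {D l : ℕ} (K : IntermediateField ℚ ℂ) (ω : Fin D → ℂ) (hωK : ∀ s, ω s ∈ K)
    (hω : LinearIndependent ℚ ω) (e : Fin 3 × Fin D ≃ Fin l) (a : Fin 3 → ℂ)
    (ha : ∀ κ : Fin 3 → ℂ, (∀ j, κ j ∈ K) → ∑ j, κ j * a j = 0 → ∀ j, κ j = 0)
    (ν : Fin l → ℤ) (h : ∑ k, (ν k : ℂ) * (ω (e.symm k).2 * a (e.symm k).1) = 0) : ν = 0 := by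
  classical
  have h' : ∑ j : Fin 3, (∑ r : Fin D, (ν (e (j, r)) : ℂ) * ω r) * a j = 0 := by
    rw [← h, ← e.sum_comp]
    simp only [Equiv.symm_apply_apply, Finset.sum_mul]
    rw [Fintype.sum_prod_type]
    refine Finset.sum_congr rfl fun j _ => Finset.sum_congr rfl fun r _ => by ring
  have hκ := ha (fun j => ∑ r : Fin D, (ν (e (j, r)) : ℂ) * ω r)
    (fun j => K.sum_mem fun r _ => K.mul_mem (by exact_mod_cast K.intCast_mem (ν (e (j, r)))) (hωK r)) h'
  funext k
  obtain ⟨⟨j, r⟩, rfl⟩ := e.surjective k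
  have hj := hκ j
  have := Fintype.linearIndependent_iff.mp hω (fun r => (ν (e (j, r)) : ℚ)) (by
    simpa [Rat.smul_def] using hj) r
  exact_mod_cast this

set_option maxHeartbeats 1600000 in
/-- **Exclusion of the obstructing subgroup** in the pencil case of the strong six exponentials
theorem. With `N = 2D` torus coordinates `(x, y)`, generators indexed by `(j, r) ∈ 3 × D`
satisfying `ω_r a_j = θ_{jr} + ω·x_{jr}`, `ω_r t a_j = ω·y_{jr}` (`ω` a `ℚ`-independent family in
the field `K ∌ t`, `ω₀ = 1`, `a_j` independent over `K`), letters spanning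
`W ⊆ {z + ω·x = 0, ω·y = 0}` with `dim W ≥ 2D - 1`, no connected algebraic subgroup `G' = V₀ × T_M`
with `r'` independent relations `σ(ρᵢ) ∈ G'` satisfies the two counting inequalities of the linear
subgroup theorem. [cite: Waldschmidt1988, §4 Thm 4.1 (structure of the conclusion); Roy1992 §4] -/
theorem exclusion {D l : ℕ} (hD : 1 ≤ D) (K : IntermediateField ℚ ℂ) (ω : Fin D → ℂ)
    (hωK : ∀ s, ω s ∈ K) (hω : LinearIndependent ℚ ω)
    (t : ℂ) (ht : t ∉ K) (e : Fin 3 × Fin D ≃ Fin l) (a : Fin 3 → ℂ)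
    (ha : ∀ κ : Fin 3 → ℂ, (∀ j, κ j ∈ K) → ∑ j, κ j * a j = 0 → ∀ j, κ j = 0)
    (θ : Fin l → ℂ) (z : Fin (D + D) → Fin l → ℂ)
    (hx : ∀ k, ω (e.symm k).2 * a (e.symm k).1 = θ k + ∑ s, ω s * z (Fin.castAdd D s) k)
    (hy : ∀ k, ω (e.symm k).2 * (t * a (e.symm k).1) = ∑ s, ω s * z (Fin.natAdd D s) k)
    (H : ConnAlgSubgroup (D + D)) {r' : ℕ} (ρ : Fin r' → Fin l → ℤ) (hρ : LinearIndependent ℤ ρ)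
    (hmem : ∀ i, sig θ z (ρ i) ∈ H.toSubgroup)
    (W : Submodule ℂ (ℂ × (Fin (D + D) → ℂ)))
    (hW : ∀ w ∈ W, w.1 + ∑ s, ω s * w.2 (Fin.castAdd D s) = 0 ∧ ∑ s, ω s * w.2 (Fin.natAdd D s) = 0)
    (hWdim : D + D ≤ finrank ℂ W + 1)
    (h1 : finrank ℂ W - finrank ℂ ↥(W ⊓ H.tangent) < (1 - H.addDim) + (D + D - H.torusDim))
    (h2 : (l - r') + (D + D - H.torusDim) + (D + D) * (finrank ℂ W - finrank ℂ ↥(W ⊓ H.tangent)) ≤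
      (D + D) * ((1 - H.addDim) + (D + D - H.torusDim))) : False := by
  classical
  -- sizes
  have hl : l = 3 * D := by simpa using (Fintype.card_congr e).symm
  have ht0 : t ≠ 0 := fun h => ht (h ▸ K.zero_mem)
  -- characters
  obtain ⟨kk, χ, hχind, hχ, hsp⟩ := exists_chars_basis H
  have hTk := finrank_torusTangent_add H hχind hχ hsp
  set T := H.torusTangent with hT
  have hb' : H.torusDim = finrank ℂ T := rfl
  -- the relation data
  let lv : (Fin l → ℤ) → Fin (D + D) → ℂ := fun ν h => ∑ k, (ν k : ℂ) * z h k
  let c0 : (Fin l → ℤ) → ℂ := fun ν => ∑ k, (ν k : ℂ) * θ k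
  let aν : (Fin l → ℤ) → ℂ := fun ν => ∑ k, (ν k : ℂ) * (ω (e.symm k).2 * a (e.symm k).1)
  have hinj : ∀ ν, aν ν = 0 → ν = 0 := fun ν h => rel_eq_zero K ω hωK hω e a ha ν h
  have key1 : ∀ ν, ∑ s, ω s * lv ν (Fin.castAdd D s) = aν ν - c0 ν := by
    intro ν
    simp only [lv, aν, c0, Finset.mul_sum, ← Finset.sum_sub_distrib]
    rw [Finset.sum_comm]
    refine Finset.sum_congr rfl fun k _ => ?_
    have := hx k
    calc ∑ s, ω s * ((ν k : ℂ) * z (Fin.castAdd D s) k) = (ν k : ℂ) * ∑ s, ω s * z (Fin.castAdd D s) k := by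
          rw [Finset.mul_sum]; exact Finset.sum_congr rfl fun s _ => by ring
      _ = _ := by rw [show ∑ s, ω s * z (Fin.castAdd D s) k = ω (e.symm k).2 * a (e.symm k).1 - θ k by
            rw [this]; ring]; ring
  have key2 : ∀ ν, ∑ s, ω s * lv ν (Fin.natAdd D s) = t * aν ν := by
    intro ν
    simp only [lv, aν, Finset.mul_sum]
    rw [Finset.sum_comm]
    refine Finset.sum_congr rfl fun k _ => ?_
    calc ∑ s, ω s * ((ν k : ℂ) * z (Fin.natAdd D s) k) = (ν k : ℂ) * ∑ s, ω s * z (Fin.natAdd D s) k := by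
          rw [Finset.mul_sum]; exact Finset.sum_congr rfl fun s _ => by ring
      _ = _ := by rw [← hy k]; ring
  -- the `k`-map and the relation predicate
  let kmap : (Fin l → ℤ) →+ (Fin kk → ℂ) :=
    { toFun := fun ν i => ∑ j, (χ i j : ℂ) * lv ν j
      map_zero' := by funext i; simp [lv]
      map_add' := fun ν ν' => by
        funext i
        simp only [lv, Pi.add_apply, Int.cast_add, add_mul, Finset.sum_add_distrib, mul_add] }
  have kmap_apply : ∀ ν i, kmap ν i = ∑ j, (χ i j : ℂ) * lv ν j := fun _ _ => rfl
  let Rel : (Fin l → ℤ) → Prop := fun ν =>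
    (H.addPart = false → c0 ν = 0) ∧ ∀ i, ∃ n : ℤ, kmap ν i = n * (2 * Real.pi * Complex.I)
  have hRelρ : ∀ i, Rel (ρ i) := by
    intro i
    obtain ⟨hadd, hchar⟩ := (sig_mem_iff H θ z (ρ i)).mp (hmem i)
    exact ⟨hadd, fun i' => hchar (χ i') (hχ i')⟩
  have hRelspan : ∀ v ∈ Submodule.span ℤ (Set.range ρ), Rel v := by
    intro v hv
    induction hv using Submodule.span_induction with
    | mem x hx => obtain ⟨i, rfl⟩ := hx; exact hRelρ i
    | zero => exact ⟨fun _ => by simp [c0], fun i => ⟨0, by simp [kmap_apply, lv]⟩⟩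
    | add x y _ _ hx hy =>
      refine ⟨fun h => ?_, fun i => ?_⟩
      · have hx1 := hx.1 h
        have hy1 := hy.1 h
        simp only [c0] at hx1 hy1 ⊢
        simp only [Pi.add_apply, Int.cast_add, add_mul, Finset.sum_add_distrib, hx1, hy1, add_zero]
      · obtain ⟨n₁, h₁⟩ := hx.2 i; obtain ⟨n₂, h₂⟩ := hy.2 i
        refine ⟨n₁ + n₂, ?_⟩
        rw [map_add, Pi.add_apply, h₁, h₂]; push_cast; ring
    | smul c x _ hx =>
      refine ⟨fun h => ?_, fun i => ?_⟩
      · have hx1 := hx.1 h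
        simp only [c0] at hx1 ⊢
        simp only [Pi.smul_apply, smul_eq_mul, Int.cast_mul, mul_assoc, ← Finset.mul_sum, hx1, mul_zero]
      · obtain ⟨n₁, h₁⟩ := hx.2 i
        refine ⟨c * n₁, ?_⟩
        rw [map_zsmul, Pi.smul_apply, h₁, zsmul_eq_mul]; push_cast; ring
  -- values of `kmap` on the relations lie in `2πiℤ^kk`
  have hval : ∀ i, ∃ n : Fin kk → ℤ, kmap (ρ i) = fun i' => (2 * Real.pi * Complex.I) * n i' := by
    intro i
    choose n hn using (hRelρ i).2
    exact ⟨n, funext fun i' => by rw [hn i']; ring⟩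
  -- expressing a vector `u ∈ span χ` against `lv ν`
  have hspan_eval : ∀ (u : Fin (D + D) → ℂ) (c : Fin kk → ℂ), u = ∑ i, c i • (fun j => (χ i j : ℂ)) →
      ∀ ν, ∑ j, u j * lv ν j = ∑ i, c i * kmap ν i := by
    intro u c hu ν
    rw [hu]
    simp only [kmap_apply, Finset.sum_apply, Pi.smul_apply, smul_eq_mul, Finset.sum_mul, Finset.mul_sum]
    rw [Finset.sum_comm]
    exact Finset.sum_congr rfl fun i _ => Finset.sum_congr rfl fun j _ => by ring
  -- the vectors `(ω, 0)`, `(0, ω)` (in `K^{D+D}`)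
  let ux : Fin (D + D) → ℂ := Fin.append ω (0 : Fin D → ℂ)
  let uy : Fin (D + D) → ℂ := Fin.append (0 : Fin D → ℂ) ω
  let uxK : Fin (D + D) → K := Fin.append (fun s => ⟨ω s, hωK s⟩) (0 : Fin D → K)
  let uyK : Fin (D + D) → K := Fin.append (0 : Fin D → K) (fun s => ⟨ω s, hωK s⟩)
  have huxK : (algebraMap K ℂ ∘ uxK) = ux := by
    funext j; refine Fin.addCases (fun s => ?_) (fun s => ?_) j
    · simp only [Function.comp_apply, ux, uxK, Fin.append_left]; rfl
    · simp only [Function.comp_apply, ux, uxK, Fin.append_right, Pi.zero_apply, map_zero]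
  have huyK : (algebraMap K ℂ ∘ uyK) = uy := by
    funext j; refine Fin.addCases (fun s => ?_) (fun s => ?_) j
    · simp only [Function.comp_apply, uy, uyK, Fin.append_left, Pi.zero_apply, map_zero]
    · simp only [Function.comp_apply, uy, uyK, Fin.append_right]; rfl
  let χK : Fin kk → Fin (D + D) → K := fun i j => (χ i j : K)
  have hχK : (fun i => algebraMap K ℂ ∘ χK i) = fun i j => (χ i j : ℂ) := by
    funext i j; simp [χK]
  have hχKind : LinearIndependent K χK := linearIndependent_cast_of_int' (F := K) χ hχind
  have hux : ∀ v : Fin (D + D) → ℂ, ∑ j, ux j * v j = ∑ s, ω s * v (Fin.castAdd D s) := dot_append_left ω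
  have huy : ∀ v : Fin (D + D) → ℂ, ∑ j, uy j * v j = ∑ s, ω s * v (Fin.natAdd D s) := dot_append_right ω
  -- dimension bookkeeping: `W ⊓ Lie G'` injects into `T ⊓ ker f₂` (and `⊓ ker f₁` if `V₀ = 0`)
  let Tx : Submodule ℂ (Fin (D + D) → ℂ) :=
    { carrier := {v | ∑ s, ω s * v (Fin.castAdd D s) = 0}
      zero_mem' := by simp
      add_mem' := fun {v v'} hv hv' => by
        simp only [Set.mem_setOf_eq, Pi.add_apply, mul_add, Finset.sum_add_distrib] at *
        rw [hv, hv', add_zero]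
      smul_mem' := fun c v hv => by
        simp only [Set.mem_setOf_eq, Pi.smul_apply, smul_eq_mul] at *
        simp_rw [mul_left_comm _ c, ← Finset.mul_sum]; rw [hv, mul_zero] }
  let Ty : Submodule ℂ (Fin (D + D) → ℂ) :=
    { carrier := {v | ∑ s, ω s * v (Fin.natAdd D s) = 0}
      zero_mem' := by simp
      add_mem' := fun {v v'} hv hv' => by
        simp only [Set.mem_setOf_eq, Pi.add_apply, mul_add, Finset.sum_add_distrib] at *
        rw [hv, hv', add_zero]
      smul_mem' := fun c v hv => by
        simp only [Set.mem_setOf_eq, Pi.smul_apply, smul_eq_mul] at *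
        simp_rw [mul_left_comm _ c, ← Finset.mul_sum]; rw [hv, mul_zero] }
  have mem_Tx : ∀ v, v ∈ Tx ↔ ∑ s, ω s * v (Fin.castAdd D s) = 0 := fun v => Iff.rfl
  have mem_Ty : ∀ v, v ∈ Ty ↔ ∑ s, ω s * v (Fin.natAdd D s) = 0 := fun v => Iff.rfl
  have mem_tangent : ∀ w : ℂ × (Fin (D + D) → ℂ), w ∈ H.tangent ↔
      w.1 ∈ (if H.addPart then ⊤ else ⊥ : Submodule ℂ ℂ) ∧ w.2 ∈ T := fun w => Submodule.mem_prod
  -- the target subspace `T'` and the injection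
  let T' : Submodule ℂ (Fin (D + D) → ℂ) := if H.addPart then T ⊓ Ty else T ⊓ Tx ⊓ Ty
  have hmapsto : ∀ w ∈ W ⊓ H.tangent, w.2 ∈ T' := by
    intro w hw
    obtain ⟨hwW, hwT⟩ := Submodule.mem_inf.mp hw
    obtain ⟨hw1, hw2⟩ := (mem_tangent w).mp hwT
    obtain ⟨hWx, hWy⟩ := hW w hwW
    by_cases hadd : H.addPart = true
    · simp only [T', hadd, if_true]
      exact Submodule.mem_inf.mpr ⟨hw2, (mem_Ty _).mpr hWy⟩
    · simp only [T', hadd, if_false, Bool.false_eq_true]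
      have h10 : w.1 = 0 := by simpa [hadd] using hw1
      refine Submodule.mem_inf.mpr ⟨Submodule.mem_inf.mpr ⟨hw2, (mem_Tx _).mpr ?_⟩, (mem_Ty _).mpr hWy⟩
      rwa [h10, zero_add] at hWx
  let g : ↥(W ⊓ H.tangent) →ₗ[ℂ] ↥T' :=
    LinearMap.codRestrict T' ((LinearMap.snd ℂ ℂ (Fin (D + D) → ℂ)).comp (W ⊓ H.tangent).subtype)
      fun w => hmapsto w w.2
  have hg : Function.Injective g := by
    intro w w' hww
    have h2 : (w : ℂ × (Fin (D + D) → ℂ)).2 = (w' : ℂ × (Fin (D + D) → ℂ)).2 := by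
      have := congrArg (fun v : ↥T' => (v : Fin (D + D) → ℂ)) hww
      simpa [g] using this
    have hd : ((w : ℂ × _) - (w' : ℂ × _)) ∈ W := W.sub_mem (Submodule.mem_inf.mp w.2).1 (Submodule.mem_inf.mp w'.2).1
    have h1 := (hW _ hd).1
    simp only [Prod.fst_sub, Prod.snd_sub, Pi.sub_apply, h2, sub_self, mul_zero, Finset.sum_const_zero,
      add_zero, sub_eq_zero] at h1
    exact Subtype.ext (Prod.ext h1 h2)
  have hdimWT : finrank ℂ ↥(W ⊓ H.tangent) ≤ finrank ℂ T' := LinearMap.finrank_le_finrank_of_injective hg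
  have hT'le : finrank ℂ T' ≤ finrank ℂ T := by
    apply Submodule.finrank_mono
    by_cases hadd : H.addPart = true
    · simp only [T', hadd, if_true]; exact inf_le_left
    · simp only [T', hadd, if_false, Bool.false_eq_true]; exact inf_le_left.trans inf_le_left
  have hTle : finrank ℂ T ≤ D + D := by
    have := Submodule.finrank_le T
    rwa [Module.finrank_fintype_fun_eq_card, Fintype.card_fin] at this
  have hWTleW : finrank ℂ ↥(W ⊓ H.tangent) ≤ finrank ℂ W := Submodule.finrank_mono inf_le_left
  have haddDim : H.addDim = if H.addPart then 1 else 0 := rfl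
  -- `r' ≤ kk` from injectivity of `kmap` on relations, in the two situations where it holds
  have hr'le : (∀ v ∈ Submodule.span ℤ (Set.range ρ), kmap v = 0 → v = 0) → r' ≤ kk := fun hk =>
    card_le_of_injOn_lattice ρ hρ kmap hk hval
  -- `K`-valued consequences are algebraic; `t ∉ K`
  have hKdiv : ∀ x y : ℂ, x ∈ K → y ∈ K → y ≠ 0 → t ≠ x / y := by
    intro x y hx hy hy0 h
    exact ht (h ▸ K.div_mem hx hy)
  ------------------------------------------------------------------
  -- Case analysis on the additive part
  ------------------------------------------------------------------
  by_cases hadd : H.addPart = true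
  · -- Case `V₀ = 𝔾ₐ`: `T' = T ⊓ ker f₂`
    have hT'eq : T' = T ⊓ Ty := by simp only [T', hadd, if_true]
    have ha1 : H.addDim = 1 := by rw [haddDim, if_pos hadd]
    rw [ha1] at h1 h2
    -- from `h1`: `dim (T ⊓ Ty) = dim T`, so `T ≤ Ty`
    have hdT : finrank ℂ T ≤ finrank ℂ ↥(T ⊓ Ty) := by
      rw [hT'eq] at hdimWT
      omega
    have hTTy : T ≤ Ty := by
      have : T ⊓ Ty = T := Submodule.eq_of_le_of_finrank_le inf_le_left hdT
      rw [← this]; exact inf_le_right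
    -- hence `(0, ω) ∈ span_ℂ χ`, and by rational choice `(0, ω) = ∑ cᵢ χᵢ` with `cᵢ ∈ K`
    have huyspan : uy ∈ Submodule.span ℂ (Set.range fun i j => (χ i j : ℂ)) := by
      refine mem_span_basis_of_forall H hsp uy fun v hv => ?_
      rw [huy]; exact (mem_Ty v).mp (hTTy hv)
    have huyK' : uyK ∈ Submodule.span K (Set.range χK) := by
      refine mem_span_of_mem_span_map χK hχKind uyK ?_
      rw [huyK, hχK]; exact huyspan
    obtain ⟨c, hc⟩ := (Submodule.mem_span_range_iff_exists_fun K).mp huyK'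
    have hcC : uy = ∑ i, ((c i : K) : ℂ) • fun j => (χ i j : ℂ) := by
      rw [← huyK, ← hc]; funext j; simp [Finset.sum_apply, χK]
    -- `t a(ν) = ∑ cᵢ kmap(ν)ᵢ`, so `kmap` is injective on all of `ℤ^l`
    have htak : ∀ ν, t * aν ν = ∑ i, ((c i : K) : ℂ) * kmap ν i := by
      intro ν; rw [← key2, ← huy]; exact hspan_eval uy _ hcC ν
    have hk : ∀ v ∈ Submodule.span ℤ (Set.range ρ), kmap v = 0 → v = 0 := by
      intro v _ hv
      apply hinj
      have := htak v
      rw [hv] at this; simp only [Pi.zero_apply, mul_zero, Finset.sum_const_zero] at this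
      exact (mul_eq_zero.mp this).resolve_left ht0
    have hr := hr'le hk
    -- counting: `r' ≥ 3D - b'` from `h2`, `r' ≤ kk = 2D - b'`
    have hb'le : finrank ℂ T ≤ D + D := hTle
    rw [hb'] at h1 h2
    have hWT : finrank ℂ ↥(W ⊓ H.tangent) ≤ finrank ℂ T := hdimWT.trans hT'le
    -- `N * (dW - dWT) ≥ N * ((N - 1) - b')`
    have hdiff : (D + D - 1) - finrank ℂ T ≤ finrank ℂ W - finrank ℂ ↥(W ⊓ H.tangent) := by omega
    have hmul := Nat.mul_le_mul_left (D + D) hdiff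
    have hkk : kk = D + D - finrank ℂ T := by omega
    have hbN : finrank ℂ T ≤ D + D - 1 := by
      by_contra hcon
      have : finrank ℂ T = D + D := by omega
      rw [this] at h1; omega
    have hr3 : 3 * D ≤ r' + finrank ℂ T := by
      -- from h2
      have hN1 : (D + D) * ((D + D - 1) - finrank ℂ T) + (D + D) = (D + D) * (D + D - finrank ℂ T) := by
        have : D + D - finrank ℂ T = ((D + D - 1) - finrank ℂ T) + 1 := by omega
        rw [this, Nat.mul_add, Nat.mul_one]
      simp only [Nat.sub_self, zero_add] at h2
      omega
    omega
  · -- Case `V₀ = 0`: `T' = T ⊓ Tx ⊓ Ty`, relations have `c0 = 0`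
    have hadd' : H.addPart = false := by simpa using hadd
    have hT'eq : T' = T ⊓ Tx ⊓ Ty := by simp only [T', hadd, if_false, Bool.false_eq_true]
    have ha0 : H.addDim = 0 := by rw [haddDim, if_neg hadd]
    rw [ha0, hb'] at h1 h2
    have hc0 : ∀ v ∈ Submodule.span ℤ (Set.range ρ), c0 v = 0 := fun v hv => (hRelspan v hv).1 hadd'
    -- `dim (T ⊓ Tx ⊓ Ty) ≥ dim T - 1`
    have hdT : finrank ℂ T ≤ finrank ℂ ↥(T ⊓ Tx ⊓ Ty) + 1 := by
      rw [hT'eq] at hdimWT; omega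
    have hdiff : (D + D - 1) - finrank ℂ ↥(T ⊓ Tx ⊓ Ty) ≤ finrank ℂ W - finrank ℂ ↥(W ⊓ H.tangent) := by
      rw [hT'eq] at hdimWT; omega
    have hmul := Nat.mul_le_mul_left (D + D) hdiff
    have hkk : kk = D + D - finrank ℂ T := by omega
    have hT3le : finrank ℂ ↥(T ⊓ Tx ⊓ Ty) ≤ finrank ℂ T := Submodule.finrank_mono (inf_le_left.trans inf_le_left)
    rcases Nat.lt_or_ge (finrank ℂ ↥(T ⊓ Tx ⊓ Ty)) (finrank ℂ T) with hlt | hge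
    · ----------------------------------------------------------------
      -- Sub-case `dim (T ⊓ Tx ⊓ Ty) = dim T - 1`: a pencil `α f₁ + β f₂` vanishes on `T`
      ----------------------------------------------------------------
      have hdeq : finrank ℂ ↥(T ⊓ Tx ⊓ Ty) + 1 = finrank ℂ T := by omega
      -- counting first: `r' ≥ 3D - b'`
      have hr3 : 3 * D ≤ r' + finrank ℂ T := by
        have hN1 : (D + D) * ((D + D - 1) - finrank ℂ ↥(T ⊓ Tx ⊓ Ty)) + (D + D) =
            (D + D) * (1 + (D + D - finrank ℂ T)) := by
          have : 1 + (D + D - finrank ℂ T) = ((D + D - 1) - finrank ℂ ↥(T ⊓ Tx ⊓ Ty)) + 1 := by omega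
          rw [this, Nat.mul_add, Nat.mul_one]
        simp only [Nat.sub_zero] at h2
        omega
      -- the map `Ψ : T → ℂ²`, `v ↦ (f₁ v, f₂ v)` has rank `1`: a non-zero functional kills its range
      let Ψ : ↥T →ₗ[ℂ] (ℂ × ℂ) :=
        { toFun := fun v => (∑ s, ω s * (v : Fin (D + D) → ℂ) (Fin.castAdd D s),
            ∑ s, ω s * (v : Fin (D + D) → ℂ) (Fin.natAdd D s))
          map_add' := fun v v' => by
            ext <;> simp [mul_add, Finset.sum_add_distrib]
          map_smul' := fun c v => by
            ext <;> simp [Finset.mul_sum, mul_left_comm] }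
      have hΨapply : ∀ v : ↥T, Ψ v = (∑ s, ω s * (v : Fin (D + D) → ℂ) (Fin.castAdd D s),
            ∑ s, ω s * (v : Fin (D + D) → ℂ) (Fin.natAdd D s)) := fun v => rfl
      have hΨker : LinearMap.ker Ψ = Submodule.comap T.subtype (T ⊓ Tx ⊓ Ty) := by
        ext v
        rw [LinearMap.mem_ker, Submodule.mem_comap, Submodule.coe_subtype, Submodule.mem_inf, Submodule.mem_inf,
          mem_Tx, mem_Ty, hΨapply, Prod.mk_eq_zero]
        exact ⟨fun ⟨h₁, h₂⟩ => ⟨⟨v.2, h₁⟩, h₂⟩, fun ⟨⟨_, h₁⟩, h₂⟩ => ⟨h₁, h₂⟩⟩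
      have hkerdim : finrank ℂ (LinearMap.ker Ψ) + 1 = finrank ℂ T := by
        rw [hΨker, ← hdeq]
        congr 1
        have hle : T ⊓ Tx ⊓ Ty ≤ T := inf_le_left.trans inf_le_left
        rw [← Submodule.finrank_map_subtype_eq T (Submodule.comap T.subtype (T ⊓ Tx ⊓ Ty)),
          Submodule.map_comap_subtype, inf_eq_right.mpr hle]
      have hrange : finrank ℂ (LinearMap.range Ψ) = 1 := by
        have := LinearMap.finrank_range_add_finrank_ker Ψ
        omega
      have hlt_top : LinearMap.range Ψ < ⊤ := by
        apply lt_top_iff_ne_top.mpr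
        intro htop
        have := congrArg (fun S : Submodule ℂ (ℂ × ℂ) => finrank ℂ S) htop
        simp only [hrange, finrank_top, Module.finrank_prod, Module.finrank_self] at this
        omega
      obtain ⟨φ, hφ0, hφ⟩ := Submodule.exists_le_ker_of_lt_top _ hlt_top
      -- `φ = (α, β)·`
      set α : ℂ := φ (1, 0) with hα
      set β : ℂ := φ (0, 1) with hβ
      have hφab : ∀ p : ℂ × ℂ, φ p = α * p.1 + β * p.2 := by
        intro p
        have : p = p.1 • (1, 0) + p.2 • (0, 1) := by ext <;> simp
        conv_lhs => rw [this]
        rw [map_add, map_smul, map_smul, smul_eq_mul, smul_eq_mul]; ring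
      have hαβ : α ≠ 0 ∨ β ≠ 0 := by
        by_contra h; push Not at h
        apply hφ0
        apply LinearMap.ext
        intro p
        simp [hφab, h.1, h.2]
      -- `α ux + β uy` vanishes on `T`
      have hvan : ∀ v ∈ T, ∑ j, (α • ux + β • uy) j * v j = 0 := by
        intro v hv
        have hr : Ψ ⟨v, hv⟩ ∈ LinearMap.range Ψ := LinearMap.mem_range_self Ψ _
        have := hφ hr
        rw [LinearMap.mem_ker, hφab] at this
        simp only [Pi.add_apply, Pi.smul_apply, smul_eq_mul, add_mul, Finset.sum_add_distrib, mul_assoc,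
          ← Finset.mul_sum]
        rw [hux, huy]
        exact this
      have hpen : ∃ α' β' : ℂ, (α' ≠ 0 ∨ β' ≠ 0) ∧ α' • (algebraMap K ℂ ∘ uxK) + β' • (algebraMap K ℂ ∘ uyK) ∈
          Submodule.span ℂ (Set.range fun i => algebraMap K ℂ ∘ χK i) := by
        refine ⟨α, β, hαβ, ?_⟩
        rw [huxK, huyK, hχK]
        exact mem_span_basis_of_forall H hsp _ hvan
      obtain ⟨α', β', hne, hmemK⟩ := exists_pencil_of_exists_pencil_map χK hχKind uxK uyK hpen
      obtain ⟨c, hc⟩ := (Submodule.mem_span_range_iff_exists_fun K).mp hmemK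
      have hcC : (α' : ℂ) • ux + (β' : ℂ) • uy = ∑ i, ((c i : K) : ℂ) • fun j => (χ i j : ℂ) := by
        have := congrArg (fun v : Fin (D + D) → K => fun j => ((v j : K) : ℂ)) hc
        rw [← huxK, ← huyK]
        convert this.symm using 1
        · funext j; simp
        · funext j; simp [Finset.sum_apply, χK]
      -- `(α' + β' t) a(ν) = ∑ cᵢ kmap(ν)ᵢ` for relations `ν`
      have hγ0 : (α' : ℂ) + (β' : ℂ) * t ≠ 0 := by
        intro h
        by_cases hβ0 : β' = 0
        · have hα0 : (α' : ℂ) = 0 := by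
            have hb : ((β' : K) : ℂ) = 0 := by rw [hβ0]; rfl
            rw [hb, zero_mul, add_zero] at h; exact h
          rcases hne with hα' | hβ'
          · exact hα' (by exact_mod_cast hα0)
          · exact hβ' hβ0
        · have hβC : ((β' : K) : ℂ) ≠ 0 := by exact_mod_cast hβ0
          refine hKdiv (-(α' : ℂ)) β' (K.neg_mem (α').2) (β').2 hβC ?_
          rw [eq_div_iff hβC]; linear_combination h
      have hrel : ∀ v ∈ Submodule.span ℤ (Set.range ρ), ((α' : ℂ) + (β' : ℂ) * t) * aν v = ∑ i, ((c i : K) : ℂ) * kmap v i := by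
        intro v hv
        have h := hspan_eval _ _ hcC v
        simp only [Pi.add_apply, Pi.smul_apply, smul_eq_mul, add_mul, Finset.sum_add_distrib, mul_assoc,
          ← Finset.mul_sum] at h
        rw [hux, huy, key1, key2, hc0 v hv, sub_zero] at h
        rw [← h]; ring
      have hk : ∀ v ∈ Submodule.span ℤ (Set.range ρ), kmap v = 0 → v = 0 := by
        intro v hv hv0
        apply hinj
        have := hrel v hv
        rw [hv0] at this; simp only [Pi.zero_apply, mul_zero, Finset.sum_const_zero] at this
        exact (mul_eq_zero.mp this).resolve_left hγ0
      have hr := hr'le hk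
      omega
    · ----------------------------------------------------------------
      -- Sub-case `T ≤ Tx ⊓ Ty`: then `T = 0` would be forced; we only need `e_h ∈ span_K χ`
      ----------------------------------------------------------------
      have hTeq : T ⊓ Tx ⊓ Ty = T := Submodule.eq_of_le_of_finrank_le (inf_le_left.trans inf_le_left) hge
      have hTTx : T ≤ Tx := by rw [← hTeq]; exact inf_le_left.trans inf_le_right
      have hTTy : T ≤ Ty := by rw [← hTeq]; exact inf_le_right
      -- rational points: `T = 0`.  We show `kk = D + D` via the `ℚ`-kernel.
      have hTbot : finrank ℂ T = 0 := by
        -- the rational kernel is zero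
        let wQ : Matrix (Fin kk) (Fin (D + D)) ℚ := fun i j => (χ i j : ℚ)
        have hrowQ : LinearIndependent ℚ wQ.row := by
          have : (fun i j => (χ i j : ℚ)) = fun i => algebraMap ℤ ℚ ∘ χ i := by funext i j; simp
          show LinearIndependent ℚ (fun i j => (χ i j : ℚ))
          rw [this, linearIndependent_algebraMap_comp_iff]; exact hχind
        have hkQ := Waldschmidt1981.finrank_ker_mulVecLin_of_linearIndependent wQ hrowQ
        have hkerQ : LinearMap.ker wQ.mulVecLin = ⊥ := by
          rw [Submodule.eq_bot_iff]
          intro v hv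
          rw [LinearMap.mem_ker, Matrix.mulVecLin_apply] at hv
          -- `cast v ∈ T`
          have hvT : (fun j => ((v j : ℚ) : ℂ)) ∈ T := by
            rw [hT, mem_torusTangent_iff_basis H hχ hsp]
            intro i
            have := congrFun hv i
            simp only [Matrix.mulVec, dotProduct, wQ, Pi.zero_apply] at this
            have := congrArg (fun q : ℚ => (q : ℂ)) this
            push_cast at this
            exact this
          have h1 := (mem_Tx _).mp (hTTx hvT)
          have h2 := (mem_Ty _).mp (hTTy hvT)
          funext j
          refine Fin.addCases (fun s => ?_) (fun s => ?_) j
          · have := Fintype.linearIndependent_iff.mp hω (fun s => v (Fin.castAdd D s)) (by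
              simpa [Rat.smul_def, mul_comm] using h1) s
            simpa using this
          · have := Fintype.linearIndependent_iff.mp hω (fun s => v (Fin.natAdd D s)) (by
              simpa [Rat.smul_def, mul_comm] using h2) s
            simpa using this
        rw [hkerQ, finrank_bot] at hkQ
        omega
      -- counting: `r' ≥ D ≥ 1`
      have hr1 : 1 ≤ r' := by
        have hN1 : (D + D) * ((D + D - 1) - finrank ℂ ↥(T ⊓ Tx ⊓ Ty)) + (D + D) + (D + D) =
            (D + D) * (1 + (D + D - finrank ℂ T)) := by
          rw [hTeq, hTbot]
          have : 1 + (D + D - 0) = (D + D - 1 - 0) + 1 + 1 := by omega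
          rw [this, Nat.mul_add, Nat.mul_add, Nat.mul_one]
        simp only [Nat.sub_zero] at h2
        have hTeq' : finrank ℂ ↥(T ⊓ Tx ⊓ Ty) = 0 := by rw [hTeq, hTbot]
        omega
      -- a non-zero relation
      let ν := ρ ⟨0, hr1⟩
      have hν0 : ν ≠ 0 := hρ.ne_zero ⟨0, hr1⟩
      have hνspan : ν ∈ Submodule.span ℤ (Set.range ρ) := Submodule.subset_span ⟨⟨0, hr1⟩, rfl⟩
      -- every `e_h` is in `span_ℂ χ` (as `T = 0`), hence in `span_K χ`
      have hTzero : T = ⊥ := Submodule.finrank_eq_zero.mp hTbot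
      have hlvK : ∀ h, ∃ κ : ℂ, κ ∈ K ∧ lv ν h = κ * (2 * Real.pi * Complex.I) := by
        intro h
        let eh : Fin (D + D) → K := fun j => if j = h then 1 else 0
        have hehC : (algebraMap K ℂ ∘ eh) = fun j => if j = h then 1 else 0 := by
          funext j; by_cases hj : j = h <;> simp [eh, hj]
        have hspanC : (fun j => if j = h then (1 : ℂ) else 0) ∈ Submodule.span ℂ (Set.range fun i j => (χ i j : ℂ)) :=
          mem_span_basis_of_forall H hsp _ fun v hv => by
            have hv' : v ∈ T := hv
            rw [hTzero, Submodule.mem_bot] at hv'; simp [hv']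
        have hehK : eh ∈ Submodule.span K (Set.range χK) := by
          refine mem_span_of_mem_span_map χK hχKind eh ?_
          rw [hehC, hχK]; exact hspanC
        obtain ⟨c, hc⟩ := (Submodule.mem_span_range_iff_exists_fun K).mp hehK
        have hcC : (fun j => if j = h then (1 : ℂ) else 0) = ∑ i, ((c i : K) : ℂ) • fun j => (χ i j : ℂ) := by
          rw [← hehC, ← hc]; funext j; simp [Finset.sum_apply, χK]
        have heval := hspan_eval _ _ hcC ν
        simp only [ite_mul, one_mul, zero_mul, Finset.sum_ite_eq', Finset.mem_univ, if_true] at heval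
        obtain ⟨-, hR⟩ := hRelspan ν hνspan
        choose n hn using hR
        refine ⟨∑ i, ((c i : K) : ℂ) * n i, K.sum_mem fun i _ => K.mul_mem (c i).2 (by exact_mod_cast K.intCast_mem (n i)), ?_⟩
        rw [heval, Finset.sum_mul]
        exact Finset.sum_congr rfl fun i _ => by rw [hn i]; ring
      choose κ hκK hκ using hlvK
      -- `a(ν) = 2πi ∑ ωₛ κ_{x,s}` and `t a(ν) = 2πi ∑ ωₛ κ_{y,s}`
      have hc0ν : c0 ν = 0 := hc0 ν hνspan
      have haν : aν ν = (∑ s, ω s * κ (Fin.castAdd D s)) * (2 * Real.pi * Complex.I) := by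
        have := key1 ν
        rw [hc0ν, sub_zero] at this
        rw [← this, Finset.sum_mul]
        exact Finset.sum_congr rfl fun s _ => by rw [hκ]; ring
      have htaν : t * aν ν = (∑ s, ω s * κ (Fin.natAdd D s)) * (2 * Real.pi * Complex.I) := by
        rw [← key2 ν, Finset.sum_mul]
        exact Finset.sum_congr rfl fun s _ => by rw [hκ]; ring
      have haν0 : aν ν ≠ 0 := fun h => hν0 (hinj ν h)
      have hκx0 : ∑ s, ω s * κ (Fin.castAdd D s) ≠ 0 := by
        intro h; apply haν0; rw [haν, h, zero_mul]
      have h2pi : (2 * Real.pi * Complex.I : ℂ) ≠ 0 := by simp [Real.pi_ne_zero, Complex.I_ne_zero]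
      refine hKdiv (∑ s, ω s * κ (Fin.natAdd D s)) (∑ s, ω s * κ (Fin.castAdd D s))
        (K.sum_mem fun s _ => K.mul_mem (hωK s) (hκK _)) (K.sum_mem fun s _ => K.mul_mem (hωK s) (hκK _)) hκx0 ?_
      rw [eq_div_iff hκx0]
      apply mul_right_cancel₀ h2pi
      rw [← htaν, haν]; ring

end Exclusion

end Literature.NumberTheory.Transcendental.StrongSixExponentials

end
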